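import Mathlib
import Summits.QuantumFields.YangMills.Theses.FemtoCutoffLadder
import Summits.QuantumFields.YangMills.Theorems.FemtoCutoffLadderLocalWallReductions

/-!
# SKELETON «comparisons» for the crux `LocalWallStep` (stmt-QuantumFields-26282, route `FemtoCutoffLadder` rev 18–20; rung R2b1 = RECORD label)

Lead seat `ym-line-fcl-p1` g9 (2026-08-28).  26282 (planner ym-idea-1 g5 LINE g5-A «one plaquette wall at a time», critic PASS-WITH-PRICE 07:03Z)
= for every wall set `Q` and `p₀ ∉ Q`: `0 < t Q`, `0 < t (Q ∪ {p₀})` and the two cross-multiplied one-wall comparisons at slack `e^{A/(β²N)}`.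
The positivity clauses hold unconditionally for EVERY wall set (`SFCompression.walledTop_pos`, lead g9 p615421), so the ONE registered stub is
the pair of COMPARISON clauses:
* `stub_localWallComparisons : LocalWallComparisons` — XL (critic P1: a CANCELLATION claim, per-wall extensive shifts of `log t`, `log s` must
  cancel to the zero-mode imprint `O(β·L⁻⁴)`; P3: one-defect relative bounds uniform over `2^N` wall sets are not in print).  FIRST ATTACK
  (critic P2): the extreme wall sets = supports `SingleWallStep` 26631 (`Q = ∅`, skeleton «comparisons» there) / `LastWallStep` 26638, both
  consequences of 26282 (p613090).
Composition (kernel-checked, in the TREE): `localWallStep_of_comparisons` (lead g9, p616201).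
HONEST FRAMING: OPEN, behind `UVStabilityNonUniqueness`; R2b1 is a RECORD rung — not infinite volume, not a mass gap, not Clay.  No summit is proved
by this line.
-/

set_option autoImplicit false

noncomputable section

open Literature.MathematicalPhysics.QuantumFieldTheory hiding SU2
open Summit.QuantumFields.YangMills.Theorems.FemtoTransferGap
open Summit.QuantumFields.YangMills.Theorems.FemtoCutoffLadder
open Summit.QuantumFields.YangMills.Theses.FemtoCutoffLadder

namespace Summit.QuantumFields.YangMills.Cruxes.LocalWallStep.Comparisons

/-- **The two one-wall comparison clauses, uniform in the wall set** (verbatim the hypothesis of `localWallStep_of_comparisons`). -/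
def LocalWallComparisons : Prop :=
  ∀ κ : ℝ, 0 < κ → κ < 1 → ∃ (A lam0 : ℝ) (L0 : ℕ), 0 ≤ A ∧ 0 < lam0 ∧ ∀ lam : ℝ, 0 < lam → lam ≤ lam0 → ∀ (L : ℕ) [NeZero L], L0 ≤ L → ∀ β : ℝ, InFemtoWindow lam β L → let W : Set (Plaquette 3 L) → (GaugeConfig 3 L SU2 → ℝ) → Prop := fun Q ψ => ∀ U, (∃ p ∈ Q, β ^ (κ - 1) < 2 - (su2Rep (plaquetteHolonomy U p.1 p.2.1.1 p.2.1.2)).trace.re) → ψ U = 0; let t : Set (Plaquette 3 L) → ℝ := fun Q => sSup (rayleighSet su2Rep L β (W Q)); let s : Set (Plaquette 3 L) → ℝ := fun Q => sInf {x : ℝ | ∃ φ : GaugeConfig 3 L SU2 → ℝ, IsPhys φ ∧ x = sSup (rayleighSet su2Rep L β fun ψ => W Q ψ ∧ l2 ψ φ = 0)}; ∀ (Q : Set (Plaquette 3 L)) (p₀ : Plaquette 3 L), p₀ ∉ Q → s (insert p₀ Q) ^ L * t Q ^ L ≤ Real.exp (A / β ^ 2 / (Fintype.card (Plaquette 3 L)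 : ℝ)) * (s Q ^ L * t (insert p₀ Q) ^ L) ∧ s Q ^ L * t (insert p₀ Q) ^ L ≤ Real.exp (A / β ^ 2 / (Fintype.card (Plaquette 3 L) : ℝ)) * (s (insert p₀ Q) ^ L * t Q ^ L)

/-- stub (the ONLY one; XL): the comparison clauses of `LocalWallStep`. -/
theorem stub_localWallComparisons : LocalWallComparisons := by
  sorry

/-- ★ The crux child `LocalWallStep` BY NAME from exactly the one declared stub (composition p616201). -/
theorem LocalWallStep_holds_of_stubs : LocalWallStep :=
  localWallStep_of_comparisons stub_localWallComparisons

end Summit.QuantumFields.YangMills.Cruxes.LocalWallStep.Comparisons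

end
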